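import Summits.HodgeConjecture.HodgeConjecture.Theorems.MarkmanPartnerTransportPicardThreeK3SquaresOneCycleThird
import Literature.AlgebraicGeometry.HodgeTheory.BettiCorrespondenceActionHodgeType
import Literature.AlgebraicGeometry.HodgeTheory.ComplexConjugationHolds

/-!
# Route MarkmanPartnerTransport · crux `PicardThreeK3Squares` (stmt-HodgeConjecture-19652) — the one-cycle
# theorems with ONE RATIONAL ALGEBRAIC CLASS on `S × S` as the only datum

In `…PicardThreeK3SquaresOneCycle{Hodge,DegreeHodge,Third}` the cycle-induced endomorphism
`e = [γ]_* = pr₁_*(pr₂^*(–) ∪ γ)` carries the hypotheses "rational" and "type-preserving" separately. For `γ` a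
RATIONAL class in `A²(S × S)` (as the class of an actual algebraic cycle is) both are automatic: `[γ]_*` is the
tree's `corrAction` (`corr_eq_corrAction`, by `rfl`), which preserves rational classes
(`isRationalClass_corrAction_complexOrientationFamily`) and Hodge types (`isOfHodgeType_corrAction_of_type_self`; an
algebraic class has type `(2,2)`). Hence, granted markings and Buskin's Thm. 1.1 exactly as before:

* `typePreserving_corr_of_mem_algebraicClasses`, `isRationalClass_corr_of_isRationalClass`;
* `hodgeConjectureFor_square_of_algebraicClass` (prime form, `ρ(S) ∉ {2, 4, 6, 10}`, non-CM) and
  `…_natDegree` (degree form): ONE rational algebraic `γ ∈ A²(S × S)` with `[γ]_* σ = ev · σ`, `ev ∉ ℚ`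
  (resp. `deg minpoly_ℚ(ev) = k`, `k·j·m + ρ(S) ≠ 22`) gives HC⁴(S × S);
* `picardThreeK3Squares_of_rationalAlgebraicClass` — crux #4 `PicardThreeK3Squares` BY NAME from «every
  non-CM projective K3 surface with `3 ≤ ρ(S) ≤ 16` and `End_Hdg T(S) ≠ ℚ` carries one rational algebraic
  `γ ∈ A²(S × S)` whose action has a `(2,0)`-eigenvalue of admissible degree».

No definition, no sorry; named facts only as displayed hypotheses (`Huybrechts_K3_marking_exists`,
`Buskin2019_hodgeIsometry_algebraic`). Prover seat hodge-nonav-19652-p1 (gen 8), `--supports stmt-HodgeConjecture-19652`.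
Nothing here proves the crux or HC.

References: C. Voisin, *Hodge Theory I*, §11.1.2 Prop. 11.20, §11.3.3 Lemma 11.41; van Geemen–Schütt, Forum Math.
Sigma 13 (2025) e2, §4.8; B. van Geemen, Michigan Math. J. 56 (2008) Lemma 3.2; N. Buskin, J. reine angew. Math.
755 (2019) Thm. 1.1.
-/

set_option linter.dupNamespace false

noncomputable section

namespace Summit.HodgeConjecture.HodgeConjecture.Theorems.MarkmanPartnerTransport.OneCycle

open scoped Manifold TensorProduct
open Module CategoryTheory MonoidalCategory CartesianMonoidalCategory Polynomial
open Literature.AlgebraicGeometry Literature.AlgebraicGeometry.Motives Literature.AlgebraicGeometry.HodgeTheory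
open Literature.AlgebraicGeometry.Hyperkaehler Literature.AlgebraicGeometry.HilbertScheme
open Literature.AlgebraicGeometry.Surfaces
open Literature.AlgebraicTopology.SingularHomology
open Summit.HodgeConjecture.HodgeConjecture.Theorems
open Summit.HodgeConjecture.HodgeConjecture.Theorems.NikulinTwinTransport
open Summit.HodgeConjecture.HodgeConjecture.Theses.MarkmanPartnerTransport

/-- `Corr[μ, hS ; γ, y] = pr₁_*(pr₂^* y ∪ γ)` on `H²(S(ℂ); ℂ)`. Local notation only. -/
local notation3 (prettyPrint := false) "Corr[" μ ", " hS " ; " γ ", " y "]" =>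
  complexGysin μ (IsSmoothProjective.tensor_holds hS hS) hS
    (SemiCartesianMonoidalCategory.fst _ _) (rfl : 2 * 1 + 2 * 2 + 2 * 2 = 2 * 1 + 2 * (2 + 2))
    (cupProduct (rfl : 2 * 1 + 2 * 2 = 2 * 1 + 2 * 2)
      (complexBetti.map (SemiCartesianMonoidalCategory.snd _ _) (2 * 1) y) γ)

/-- `Scalar[S]`: «`End_Hdg T(S) = ℚ`» (VERBATIM the clause of `HighPicard` / `…OneCycleThird`). Local notation only. -/
local notation3 (prettyPrint := false) "Scalar[" S "]" =>
  (∀ (f : complexBetti S (2 * 1) →ₗ[ℂ] complexBetti S (2 * 1)),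
    (∀ y, IsRationalClass y → IsRationalClass (f y)) →
    (∀ (i j : ℕ) y, IsOfHodgeType 2 S (2 * 1) i j y → IsOfHodgeType 2 S (2 * 1) i j (f y)) →
    (∀ d ∈ algebraicClasses S 1, f d = 0) →
    (∀ y : complexBetti S (2 * 1), ∀ d ∈ algebraicClasses S 1,
      cupProduct (rfl : 2 * 1 + 2 * 1 = 2 * 2) (f y) d = 0) →
    ∃ a : ℚ, ∀ y : complexBetti S (2 * 1),
      (∀ d ∈ algebraicClasses S 1, cupProduct (rfl : 2 * 1 + 2 * 1 = 2 * 2) y d = 0) →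
        f y = (a : ℂ) • y)

variable {S : SchemeOver ℂ}

/-! ### `[γ]_*` is the tree's `corrAction`; it is type-preserving for algebraic `γ` and rational for rational `γ` -/

/-- `pr₁_*(pr₂^* y ∪ γ)` is the tree's correspondence action `corrAction … γ y` (by `rfl`). [folklore] -/
theorem corr_eq_corrAction (hS : IsSmoothProjective 2 S) (γ : complexBetti (S ⊗ S) (2 * 2))
    (y : complexBetti S (2 * 1)) :
    Corr[complexOrientationFamily, hS ; γ, y] =
      corrAction complexOrientationFamily hS hS (rfl : 2 * 1 + 2 * 2 = 2 * 1 + 2 * 2) γ y :=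
  rfl

/-- **`[γ]_*` preserves Hodge types for `γ ∈ A²(S × S)`** (`γ` has type `(2,2)`; a class of type `(c,c)` acts
with bidegree `(c − dim S, c − dim S) = (0,0)`). [cite: VoisinHodgeI2002, §11.1.2 Prop. 11.20 and §11.3.3 Lemma 11.41] -/
theorem typePreserving_corr_of_mem_algebraicClasses (hS : IsSmoothProjective 2 S)
    {γ : complexBetti (S ⊗ S) (2 * 2)} (hγ : γ ∈ algebraicClasses (S ⊗ S) 2) (i j : ℕ) (y : complexBetti S (2 * 1))
    (hy : IsOfHodgeType 2 S (2 * 1) i j y) :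
    IsOfHodgeType 2 S (2 * 1) i j (Corr[complexOrientationFamily, hS ; γ, y]) := by
  rw [corr_eq_corrAction]
  exact isOfHodgeType_corrAction_of_type_self complexOrientationFamily exists_isReal_hodgeModel_holds hS hS rfl
    (isOfHodgeType_of_mem_algebraicClasses_of_isSmoothProjective (hS.tensor_holds hS) 2 hγ) (by omega) (by omega) hy

/-- **`[γ]_*` preserves rational classes for rational `γ`** (complex orientations).
[cite: VoisinHodgeI2002, §11.1.2 Prop. 11.20] -/
theorem isRationalClass_corr_of_isRationalClass (hS : IsSmoothProjective 2 S) {γ : complexBetti (S ⊗ S) (2 * 2)}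
    (hγrat : IsRationalClass γ) (y : complexBetti S (2 * 1)) (hy : IsRationalClass y) :
    IsRationalClass (Corr[complexOrientationFamily, hS ; γ, y]) := by
  rw [corr_eq_corrAction]
  exact isRationalClass_corrAction_complexOrientationFamily hS hS rfl hγrat hy

/-! ### One rational algebraic class suffices -/

/-- **ONE rational algebraic class suffices, prime form**: a projective K3 surface with `ρ(S) ∉ {2, 4, 6, 10}`
(`d · m + ρ(S) = 22 ⇒ d` prime), not CM, carrying ONE rational algebraic `γ ∈ A²(S × S)` with
`[γ]_* σ₀ = ev · σ₀` on a non-zero `(2,0)`-class, `ev ∉ ℚ`, satisfies HC⁴(S × S) — granted markings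
(`hodgeConjectureFor_square_of_oneCycle` with `e = [γ]_*`, rational and type-preserving by the lemmas above).
[cite: GeemenSchutt2023, §4.8 and Rem. 4.9] [cite: Vangeemen2008, Lemma 3.2] [cite: VoisinHodgeI2002, §11.1.2 Prop. 11.20] -/
theorem hodgeConjectureFor_square_of_algebraicClass (hmark : Huybrechts_K3_marking_exists) (hS : IsK3Surface S)
    (hρ : ∀ d m : ℕ, 2 ≤ d → 3 ≤ m → d * m + Module.finrank ℂ ↥(algebraicClasses S 1) = 22 → d.Prime)
    (hCM : ¬ HasComplexMultiplication S) {γ : complexBetti (S ⊗ S) (2 * 2)} (hγ : γ ∈ algebraicClasses (S ⊗ S) 2)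
    (hγrat : IsRationalClass γ)
    (hev : ∃ (σ₀ : complexBetti S (2 * 1)) (ev : ℂ), IsOfHodgeType 2 S (2 * 1) 2 0 σ₀ ∧ σ₀ ≠ 0 ∧
      Corr[complexOrientationFamily, hS.isSmoothProjective ; γ, σ₀] = ev • σ₀ ∧ ∀ a : ℚ, (a : ℂ) ≠ ev) :
    HodgeConjectureFor 4 (S ⊗ S) :=
  hodgeConjectureFor_square_of_oneCycle hmark hS hρ hCM complexOrientationFamily
    (corrAction complexOrientationFamily hS.isSmoothProjective hS.isSmoothProjective
      (rfl : 2 * 1 + 2 * 2 = 2 * 1 + 2 * 2) γ)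
    (isRationalClass_corr_of_isRationalClass hS.isSmoothProjective hγrat)
    (typePreserving_corr_of_mem_algebraicClasses hS.isSmoothProjective hγ) ⟨γ, hγ, fun _ => rfl⟩ hev

/-- **ONE rational algebraic class suffices, degree form** (`deg minpoly_ℚ(ev) = k`, `k · j · m + ρ(S) ≠ 22` for
`j ≥ 2`, `m ≥ 3`), not CM, granted markings. [cite: GeemenSchutt2023, §4.8 and Rem. 4.9] [cite: Vangeemen2008, Lemma 3.2] -/
theorem hodgeConjectureFor_square_of_algebraicClass_natDegree (hmark : Huybrechts_K3_marking_exists)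
    (hS : IsK3Surface S) {k : ℕ}
    (hk : ∀ j m : ℕ, 2 ≤ j → 3 ≤ m → k * j * m + Module.finrank ℂ ↥(algebraicClasses S 1) ≠ 22)
    (hCM : ¬ HasComplexMultiplication S) {γ : complexBetti (S ⊗ S) (2 * 2)} (hγ : γ ∈ algebraicClasses (S ⊗ S) 2)
    (hγrat : IsRationalClass γ)
    (hev : ∃ (σ₀ : complexBetti S (2 * 1)) (ev : ℂ), IsOfHodgeType 2 S (2 * 1) 2 0 σ₀ ∧ σ₀ ≠ 0 ∧
      Corr[complexOrientationFamily, hS.isSmoothProjective ; γ, σ₀] = ev • σ₀ ∧ (minpoly ℚ ev).natDegree = k) :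
    HodgeConjectureFor 4 (S ⊗ S) :=
  hodgeConjectureFor_square_of_oneCycle_natDegree hmark hS hk hCM complexOrientationFamily
    (corrAction complexOrientationFamily hS.isSmoothProjective hS.isSmoothProjective
      (rfl : 2 * 1 + 2 * 2 = 2 * 1 + 2 * 2) γ)
    (isRationalClass_corr_of_isRationalClass hS.isSmoothProjective hγrat)
    (typePreserving_corr_of_mem_algebraicClasses hS.isSmoothProjective hγ) ⟨γ, hγ, fun _ => rfl⟩ hev

/-- **`PicardThreeK3Squares` BY NAME from one rational algebraic class per surface**: if every non-CM projective
K3 surface with `3 ≤ ρ(S) ≤ 16` whose transcendental Hodge endomorphisms are not all scalar carries a rational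
algebraic `γ ∈ A²(S × S)` with `[γ]_* σ₀ = ev · σ₀` on a non-zero `(2,0)`-class, `deg minpoly_ℚ(ev) = k`,
`k·j·m + ρ(S) ≠ 22`, then the crux holds — granted Buskin's Thm. 1.1 and markings
(`picardThreeK3Squares_of_oneCycleThird`). [cite: GeemenSchutt2023, §4.8, Rem. 4.9 and §6.4]
[cite: Vangeemen2008, Lemma 3.2] [cite: Buskin2019, Thm. 1.1] -/
theorem picardThreeK3Squares_of_rationalAlgebraicClass (hB : Buskin2019_hodgeIsometry_algebraic)
    (hmark : Huybrechts_K3_marking_exists)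
    (hOne : ∀ (S : SchemeOver ℂ) (hS : IsK3Surface S), ¬ HasComplexMultiplication S →
      3 ≤ Module.finrank ℂ ↥(algebraicClasses S 1) → Module.finrank ℂ ↥(algebraicClasses S 1) ≤ 16 →
      ¬ Scalar[S] →
      ∃ (k : ℕ) (γ : complexBetti (S ⊗ S) (2 * 2)), γ ∈ algebraicClasses (S ⊗ S) 2 ∧ IsRationalClass γ ∧
        (∀ j m : ℕ, 2 ≤ j → 3 ≤ m → k * j * m + Module.finrank ℂ ↥(algebraicClasses S 1) ≠ 22) ∧
        ∃ (σ₀ : complexBetti S (2 * 1)) (ev : ℂ), IsOfHodgeType 2 S (2 * 1) 2 0 σ₀ ∧ σ₀ ≠ 0 ∧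
          Corr[complexOrientationFamily, hS.isSmoothProjective ; γ, σ₀] = ev • σ₀ ∧ (minpoly ℚ ev).natDegree = k) :
    PicardThreeK3Squares := by
  refine picardThreeK3Squares_of_oneCycleThird hB hmark fun S hS hCM h3 h16 hQ => ?_
  obtain ⟨k, γ, hγ, hγrat, hk, hev⟩ := hOne S hS hCM h3 h16 hQ
  exact ⟨k, corrAction complexOrientationFamily hS.isSmoothProjective hS.isSmoothProjective
      (rfl : 2 * 1 + 2 * 2 = 2 * 1 + 2 * 2) γ, hk,
    isRationalClass_corr_of_isRationalClass hS.isSmoothProjective hγrat,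
    typePreserving_corr_of_mem_algebraicClasses hS.isSmoothProjective hγ, ⟨γ, hγ, fun _ => rfl⟩, hev⟩

end Summit.HodgeConjecture.HodgeConjecture.Theorems.MarkmanPartnerTransport.OneCycle

end
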